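import Literature.Barriers.HubbardSuperconductivity.StrongCouplingCeiling
import Literature.MathematicalPhysics.QuantumLattice.HubbardAtomicLimit
import Mathlib.Analysis.SpecialFunctions.Log.Deriv
import HarnessLib

/-!
# The strong-coupling ceiling at `t = 0`: the atomic-limit slice of `StrongCouplingCeiling` (proved)

First PROVED slice of the barrier fact
`Literature.Barriers.HubbardSuperconductivity.StrongCouplingCeiling` (Ueltschi 1999, Thm 3.1 on
`D₁` via Thm 2.1 (i)): in the atomic limit `t = 0` the finite-volume free energy density of the
box `{-L,…,L}²` is the `L`-independent classical free energy
`f₀(β, μ) = -β⁻¹ log (1 + 2e^{βμ} + e^{-β(U - 2μ)})` of Ueltschi's §3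
(`Literature.MathematicalPhysics.QuantumLattice.partitionFn_hamiltonianWith_zero_hopping_ofReal`,
`HubbardAtomicLimit.lean`), so the thermodynamic limit exists trivially and is jointly
real-analytic in `(β, μ)` for `β > 0` — the conclusion of `StrongCouplingCeiling` on the slice
`t = 0` of its domain `{β t < ε}`, for every `U` and `μ` (`strongCouplingCeiling_zero_hopping`).
The general case `0 ≤ β t < ε` is the cluster expansion (Ueltschi Thm 2.1 (i); in progress in
`Probability/LatticeModels/ClusterExpansion*` and the quantum-lattice files); this file fixes the
normalisations (`boxFreeEnergy`, `freeEnergy`, `Real.log ∘ re`) against the tree's model once.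

## Main results

* `boxFreeEnergy_zero_hopping`: `f_L(0, U, μ, β) = -β⁻¹ log z₀(β, U, μ)` for `β ≠ 0`, all `L`.
* `freeEnergy_zero_hopping`: the same for the `limUnder`.
* `analyticAt_atomicFreeEnergy`: `(β, μ) ↦ -β⁻¹ log z₀(β, U, μ)` is real-analytic at `β ≠ 0`.
* `strongCouplingCeiling_zero_hopping`: for `β > 0`, convergence `f_L → f` and joint analyticity of
  `(β', μ') ↦ freeEnergy 0 U μ' β'` at `(β, μ)`.

## References

* D. Ueltschi, J. Stat. Phys. 95 (1999) 693–717, §2.1 (classical free energy `f₀`), §3 (proof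
  of Thm 3.1, `f₀(β,μ) = -β⁻¹ log[1 + 2e^{βμ} + e^{-βU+2βμ}]`). [Ueltschi1999]
-/

noncomputable section

namespace Literature.Barriers.HubbardSuperconductivity

open Filter Literature.MathematicalPhysics.QuantumLattice
open scoped _root_.Topology

/-- In the atomic limit the finite-volume free energy density of every box is the classical free
energy `f₀ = -β⁻¹ log z₀`. [cite: Ueltschi1999, §3 (formula for f₀(β, μ))] -/
theorem boxFreeEnergy_zero_hopping (U μ : ℝ) {β : ℝ} (hβ : β ≠ 0) (L : ℕ) :
    boxFreeEnergy 0 U μ β L = -β⁻¹ * Real.log (atomicPartitionFnReal β U μ) := by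
  -- the atomic-limit partition function (the `DecidableEq` instance on the box chosen by the
  -- barrier file differs syntactically from the generic one, whence `convert`)
  have h : (hamiltonianWith (fermionBoxGraph 2 L) 0 U μ).partitionFn β =
      ((atomicPartitionFnReal β U μ ^ Fintype.card (FermionBox 2 L) : ℝ) : ℂ) := by
    convert partitionFn_hamiltonianWith_zero_hopping_ofReal (fermionBoxGraph 2 L) β U μ
  rw [boxFreeEnergy_def, h, Complex.ofReal_re, Real.log_pow, card_fermionBox_two]
  have hcard : ((((2 * L + 1) ^ 2 : ℕ)) : ℝ) ≠ 0 := by positivity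
  field_simp

/-- In the atomic limit the infinite-volume free energy density is `f₀ = -β⁻¹ log z₀`
(limit of a constant sequence). [cite: Ueltschi1999, §2.1 (f₀ is the free energy at T = 0) and §3] -/
theorem freeEnergy_zero_hopping (U μ : ℝ) {β : ℝ} (hβ : β ≠ 0) :
    freeEnergy 0 U μ β = -β⁻¹ * Real.log (atomicPartitionFnReal β U μ) := by
  unfold freeEnergy
  rw [show (fun L : ℕ => boxFreeEnergy 0 U μ β L) =
      fun _ => -β⁻¹ * Real.log (atomicPartitionFnReal β U μ) from
    funext fun L => boxFreeEnergy_zero_hopping U μ hβ L]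
  exact tendsto_const_nhds.limUnder_eq

/-- The classical free energy `(β, μ) ↦ -β⁻¹ log z₀(β, U, μ)` is jointly real-analytic at every
point with `β ≠ 0` (`z₀ > 0` is analytic, `log` is analytic on `(0, ∞)`, `β⁻¹` at `β ≠ 0`).
[cite: Ueltschi1999, §1 ("such a zero-dimensional system is free from phase transitions, hence its free energy is analytic")] -/
theorem analyticAt_atomicFreeEnergy (U : ℝ) {p : ℝ × ℝ} (hp : p.1 ≠ 0) :
    AnalyticAt ℝ (fun q : ℝ × ℝ => -q.1⁻¹ * Real.log (atomicPartitionFnReal q.1 U q.2)) p := by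
  have h1 : AnalyticAt ℝ (fun q : ℝ × ℝ => q.1⁻¹) p := analyticAt_fst.inv hp
  have h2 : AnalyticAt ℝ (Real.log ∘ fun q : ℝ × ℝ => atomicPartitionFnReal q.1 U q.2) p :=
    AnalyticAt.comp (f := fun q : ℝ × ℝ => atomicPartitionFnReal q.1 U q.2) (x := p)
      (analyticAt_log (atomicPartitionFnReal_pos p.1 U p.2)) (analyticAt_atomicPartitionFnReal U p)
  exact h1.neg.mul h2

/-- **`StrongCouplingCeiling` on the slice `t = 0`** (proved): for every `U`, `μ` and `β > 0`
the free energy density of the boxes converges (it is constant in `L`) and the limit is jointly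
real-analytic in `(β, μ)`. This is the conclusion of the barrier fact at hopping `t = 0`, where
its hypothesis `β t < ε` holds for every `ε > 0`. [cite: Ueltschi1999, Theorem 3.1 (domain D₁) with Theorem 2.1 (i), case t = 0] -/
theorem strongCouplingCeiling_zero_hopping (U μ : ℝ) {β : ℝ} (hβ : 0 < β) :
    Tendsto (fun L : ℕ => boxFreeEnergy 0 U μ β L) atTop (𝓝 (freeEnergy 0 U μ β)) ∧
      AnalyticAt ℝ (fun p : ℝ × ℝ => freeEnergy 0 U p.2 p.1) (β, μ) := by
  refine ⟨?_, ?_⟩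
  · rw [freeEnergy_zero_hopping U μ hβ.ne',
      show (fun L : ℕ => boxFreeEnergy 0 U μ β L) =
        fun _ => -β⁻¹ * Real.log (atomicPartitionFnReal β U μ) from
      funext fun L => boxFreeEnergy_zero_hopping U μ hβ.ne' L]
    exact tendsto_const_nhds
  · have hev : (fun p : ℝ × ℝ => freeEnergy 0 U p.2 p.1) =ᶠ[𝓝 (β, μ)]
        fun q : ℝ × ℝ => -q.1⁻¹ * Real.log (atomicPartitionFnReal q.1 U q.2) := by
      have hopen : IsOpen {q : ℝ × ℝ | q.1 ≠ 0} := isOpen_ne_fun continuous_fst continuous_const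
      filter_upwards [hopen.mem_nhds (show (β, μ) ∈ {q : ℝ × ℝ | q.1 ≠ 0} from hβ.ne')] with q hq
      exact freeEnergy_zero_hopping U q.2 hq
    exact (analyticAt_atomicFreeEnergy U (p := (β, μ)) hβ.ne').congr hev.symm

end Literature.Barriers.HubbardSuperconductivity
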